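import Summits.QuantumFields.BalabanUV.T4Continuum.Support.NE9CurChartTowerPiLatticeUniformClass
import Literature.MathematicalPhysics.QuantumFieldTheory.Balaban1983to89.B9Eq3117ConjugationDefects

/-!
# NE9CurChartTowerPiLatticeUniformFlatWitness — NON-VACUITY OF THE LATTICE-UNIFORM k-LEVEL CHART, UNIFORMLY: the FLAT background `U ≡ 1` of EVERY lattice of the
# tower (any height, spacing on the diagonal, period) lies in print's small-field class at `α = 0`, current `j₀ = 0`, with the top-level weight profile of (115)
# (`lev ≡ n+1`: every weight `= 1`, so `ω = Ω = 1`) — hence inside the ONE ball of `Support/NE9CurChartTowerPiLatticeUniformClass` (this seat, (I-7)); cell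
# `pub-balaban`, T4-DAG §2 node U3 ∕ §6 NE9, route R2′; NE9 crux-team (2) leaf prover 01 (`b2b-balaban-t4-ne9-formalise-leaf-01`, gen 96); Summits-side NEW
# sibling leaf under this seat's INTERFACE REQUEST NE9 [NE9LEAF01-G96-IFR]; a PRICING aid (the refuter's standing question «is the ∃-first block inhabited for all
# heights at once?» — YES, at least by the vacuum of every lattice); nothing printed asserted

HONEST FRAMING (T4-DAG PAGE 1).  Rung (B)+1 of the FINITE-VOLUME T⁴ programme — NOT infinite volume, NOT a mass gap, NOT the Clay problem.  NE9 is a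
cell NEW ESTIMATE, NOT PRINTED in [Balaban1987RG1] ∕ [Balaban1988RG2Cluster], and NOT PROVED here («NE9 ⇐ the named binders»; spine PROVED 0∕9).  HONEST
DEPENDENCY (cell line, verbatim): continuum YM on T⁴ ⇐ BetaPertH ∧ nine spine estimates (0/9 proved); BetaPertH ⇐ (D1) ∧ (D4) ∧ CAP+tail; G-an2-4
gates asym, D1 and NE2/3/4.

WHAT THIS FILE PROVES (0 def, 0 sorry, axioms standard; [folklore]).
* §1 **`flat_mem_class`** — at `U ≡ 1` on `T_{L^{n+1}m}`: `Ũ ∈ unitaryUnits`, the three windows at `α = 0`, the current `J ≡ 0` ((3.11) unfolded by this lineage's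
  `B9Eq3117ConjugationDefects.J_eq_sum`, `plaqU ≡ 1`, `Im 1 = 0`).
* §2 **`topLevel_weights`** — on the diagonal `ηL^{n+1} = 1` the (115) weights at the constant level maps `n+1` are `1`: `w̄₀, w̄₁ ≤ 1`, `w̲₃⁻¹, w̲_B⁻¹ ≤ 1`.
* §3 **`flat_chart_lattice_uniform`** — (I-7) READ AT THE VACUUM: with (I-7)'s radii at `ω = Ω = 1`, for EVERY `n, η, c₀, c₁, m` on the diagonal and every
  admissible (L3) slot, `∃ h52 hpos′ hposπ` and the triple (Ψ1)–(Ψ3) for every `Φ` agreeing with the chart at `U ≡ 1`.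
DISGUISE TEST: a witness, not an estimate; no inequality of the series; not NE9.
References (TYPES ∕ loci only): [Balaban1985BackgroundPropagators] (3.11) p. 392, (3.35)–(3.36) p. 396, (3.122) p. 420; [Balaban1985Variational] (115) p. 294,
(174) p. 305.
-/

noncomputable section

open Metric Set

namespace Summit.QuantumFields.BalabanUV.T4Continuum.NE9CurChartTowerPiLatticeUniformFlatWitness

open scoped InnerProductSpace ComplexConjugate BigOperators NNReal
open Literature.MathematicalPhysics.QuantumFieldTheory.Balaban1983to89
open B11Eq103H1Complex B11Eq115Space B11Eq174Chart
open B11Eq111FrakG (nabla115)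
open B13Contraction113 (QuadAnalytic)
open B9SectCLatticeCarrier (Bond bpos btgt unshift)
open B4Sect5Torus (TSite)
open B7Prop1Explicit (U1 Wcx boxVec)
open B7Prop2Explicit (pdev AvgClosed C0 c2' unitaryUnits avgClosed_unitaryUnits unitaryUnits_le_U1)
open B7Prop3Flat (c3)
open B9Eq315QTorus (perCfg cornerSite perCfg_apply)
open B9Eq315QTower (towerP UlevOf)
open B9Eq326OperatorTower (QkW QkW_surjective laplaceAk)
open B9Eq310HessianOperator (adTransportW)
open B9Eq310DeltaPrime (plaqHolU plaqHolU_one)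
open B9Eq324DeltaPrimeATower (laplacePrimeAk)
open B9Eq3119DeltaPiTower (laplaceAkPi)
open B11Eq44COperatorTower (αT αT_le ulev_mem_U1_of_pdev)
open B11Eq44COperatorTowerGeometric (ulev_reg_of_pdev_geometric geomProfile_le_αT)
open B11Eq44CLetterTower (Cck)
open B9Eq39Adjoint (plaqU J)
open B9Eq37Insertion (imC imC_one)
open B9Eq3117ConjugationDefects (J_eq_sum)
open Summit.QuantumFields.BalabanUV.T4Continuum.NE9CurChartTowerPiLatticeUniformClass (cur_chart_exists_tower_pi_of_unitary_class_lattice_uniform)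

/-! ## §1 The vacuum is in print's class at `α = 0`, `j₀ = 0` -/

section Flat

variable {d : ℕ} (L : ℕ) [NeZero L] (m : Fin d → ℕ) [∀ i, NeZero (m i)] (n : ℕ) (η : ℝ)
  {𝔸 : Type*} [NormedRing 𝔸] [NormedAlgebra ℂ 𝔸] [StarRing 𝔸]

/-- **THE VACUUM `U ≡ 1` IS IN PRINT's SMALL-FIELD CLASS WITH `α = 0` AND CURRENT `0`**: unitary values, `‖U(b) − 1‖ ≤ 0·η`, `‖U(∂p) − 1‖ ≤ 0·η²`,
`‖U(x,μ) − U(x−e_μ,μ)‖ ≤ 0·η²`, `‖J(μ,y)‖ ≤ 0` ((3.11): every plaquette variable is `1`, `Im 1 = 0`). [folklore]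
[cite: Balaban1985BackgroundPropagators, (3.35)–(3.36) p.396, (3.11) p.392] -/
theorem flat_mem_class :
    (∀ (x : B7Prop1Explicit.Site d) (κ : Fin d), perCfg (towerP L m (n + 1)) (fun _ : Bond d (towerP L m (n + 1)) => (1 : 𝔸ˣ)) x κ ∈ unitaryUnits 𝔸) ∧
    (∀ _b : Bond d (towerP L m (n + 1)), ‖((1 : 𝔸ˣ) : 𝔸) - 1‖ ≤ 0 * η) ∧
    (∀ p : B9SectCLatticeCarrier.Plaq d (towerP L m (n + 1)), ‖(plaqHolU (fun _ : Bond d (towerP L m (n + 1)) => (1 : 𝔸ˣ)) p : 𝔸) - 1‖ ≤ 0 * η ^ 2) ∧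
    (∀ (_x : TSite d (towerP L m (n + 1))) (_μ : Fin d), ‖((1 : 𝔸ˣ) : 𝔸) - ((1 : 𝔸ˣ) : 𝔸)‖ ≤ 0 * η ^ 2) ∧
    (∀ (μ : Fin d) (y : TSite d (towerP L m (n + 1))),
      ‖J (fun μ => B9Eq33CovDerivVector.shiftEquiv (Pd := towerP L m (n + 1)) μ) (fun (_ : Fin d) (_ : TSite d (towerP L m (n + 1))) => (1 : 𝔸ˣ)) η μ y‖ ≤ 0) := by
  refine ⟨fun x κ => ?_, fun b => by simp, fun p => by rw [plaqHolU_one, Units.val_one, sub_self, norm_zero, zero_mul],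
    fun x μ => by simp, fun μ y => ?_⟩
  · rw [perCfg_apply]; exact Subgroup.one_mem _
  · have hJ : J (fun μ => B9Eq33CovDerivVector.shiftEquiv (Pd := towerP L m (n + 1)) μ)
        (fun (_ : Fin d) (_ : TSite d (towerP L m (n + 1))) => (1 : 𝔸ˣ)) η μ y = 0 := by
      have h := J_eq_sum (Pd := towerP L m (n + 1)) (fun _ : Bond d (towerP L m (n + 1)) => (1 : 𝔸ˣ)) η μ y
      have hp : ∀ (κ ν : Fin d) (x : TSite d (towerP L m (n + 1))),
          plaqU (fun μ => B9Eq33CovDerivVector.shiftEquiv (Pd := towerP L m (n + 1)) μ)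
            (fun (_ : Fin d) (_ : TSite d (towerP L m (n + 1))) => (1 : 𝔸ˣ)) κ ν x = 1 := fun κ ν x => by
        simp [plaqU]
      simp only [hp, imC_one, mul_zero, zero_mul, sub_self, Finset.sum_const_zero, smul_zero] at h
      exact h
    rw [hJ, norm_zero]

end Flat

/-! ## §2 The top-level weight profile of (115) on the diagonal -/

section Weights

variable {ι : Type*} [Fintype ι] {L η : ℝ} [Fact (0 < L)] [Fact (0 < η)]

/-- **On the diagonal `ηL^{n+1} = 1`, the (115) weights at the constant level `n+1` are all `1`**: `w̄ ≤ 1` and `w̲⁻¹ ≤ 1` for every exponent. [folklore]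
[cite: Balaban1985Variational, (115) p.294, p.286] -/
theorem topLevel_weights {n : ℕ} (hηL : η * L ^ (n + 1) = 1) (j : ℕ) :
    (NegSup.wSup (levWeight L η (fun _ : ι => n + 1) j) : ℝ) ≤ 1 ∧ (NegSup.wInvSup (levWeight L η (fun _ : ι => n + 1) j) : ℝ) ≤ 1 := by
  have hw : ∀ i : ι, levWeight L η (fun _ : ι => n + 1) j i = 1 := fun i => by
    rw [levWeight_apply, mul_comm, hηL, one_pow]
  refine ⟨?_, ?_⟩
  · have h : NegSup.wSup (levWeight L η (fun _ : ι => n + 1) j) ≤ 1 :=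
      Finset.sup_le fun i _ => by
        rw [← NNReal.coe_le_coe, NegSup.coe_wNN (w := levWeight L η (fun _ : ι => n + 1) j), hw i, NNReal.coe_one]
    exact_mod_cast h
  · have h : NegSup.wInvSup (levWeight L η (fun _ : ι => n + 1) j) ≤ 1 :=
      Finset.sup_le fun i _ => by
        refine inv_le_one_of_one_le₀ ?_
        rw [← NNReal.coe_le_coe, NegSup.coe_wNN (w := levWeight L η (fun _ : ι => n + 1) j), hw i, NNReal.coe_one]
    exact_mod_cast h

/-- The zero-exponent weights are `1` on any lattice: `w̲_B⁻¹ ≤ 1` for `levWeight L η levB 0`. [folklore] [cite: Balaban1985Variational, (103) p.293] -/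
theorem zeroExp_weights (levB : ι → ℕ) : (NegSup.wInvSup (levWeight L η levB 0) : ℝ) ≤ 1 := by
  have h : NegSup.wInvSup (levWeight L η levB 0) ≤ 1 :=
    Finset.sup_le fun i _ => by
      refine inv_le_one_of_one_le₀ ?_
      rw [← NNReal.coe_le_coe, NegSup.coe_wNN (w := levWeight L η levB 0), levWeight_apply, pow_zero, NNReal.coe_one]
  exact_mod_cast h

end Weights


/-! ## §3 (I-7) read at the vacuum of every lattice -/

section Corollary

variable {d : ℕ} (hd : 1 ≤ d) (L : ℕ) [NeZero L] (hL : 1 ≤ L) (hL2 : 2 ≤ L) (hL3 : 3 ≤ L) [Fact (0 < (L : ℝ))]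
  {𝔸 : Type*} [CStarAlgebra 𝔸] [Nontrivial 𝔸] [FiniteDimensional ℂ 𝔸]
  {W : Type*} [NormedAddCommGroup W] [InnerProductSpace ℂ W] [FiniteDimensional ℂ W] (φ : W ≃ₗ[ℂ] 𝔸)
  {Mφ Mφ' : ℝ} (hMφ : 0 ≤ Mφ) (hMφ' : 0 ≤ Mφ') (hφ : ∀ w, ‖φ w‖ ≤ Mφ * ‖w‖) (hφ' : ∀ X, ‖φ.symm X‖ ≤ Mφ' * ‖X‖)
  {a : ℝ} (ha : 0 < a) {a' : ℝ} (ha' : 0 < a')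
  (τ : 𝔸 →ₗ[ℂ] ℂ) {Cτ : ℝ} (hτ : ∀ X, ‖τ X‖ ≤ Cτ * ‖X‖) (hCτ : 0 ≤ Cτ) {Mτ : ℝ} (hτm : ∀ X Y : 𝔸, ‖τ (X * Y)‖ ≤ Mτ * ‖X‖ * ‖Y‖) (hMτ : 0 ≤ Mτ)
  {ρw : ℝ} (hρw : 0 ≤ ρw)
  (hτ₁ : ∀ X : 𝔸, τ (star X) = conj (τ X)) (hτ₂ : ∀ X Y : 𝔸, τ (X * Y) = τ (Y * X)) (hφτ : ∀ X Y : 𝔸, ⟪φ.symm X, φ.symm Y⟫_ℂ = τ (star X * Y))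
  {α₀ : ℝ} (hα₀ : 0 < α₀) (hα3 : C0 d * α₀ ≤ 1 / 3) (hα4 : 4 * α₀ ≤ c2' d L)
  (hαL : 50 * (d + 1) * αT d L α₀ * (L : ℝ) ^ d ≤ 1 / 2)
  {ρ : ℝ} (hρ0 : 0 < ρ) (hρ : Real.exp (4 * (800 * ((d : ℝ) + 1) ^ 2 * ((d : ℝ) + 4)) * α₀) * (1 + 8 * (131072 * ((d : ℝ) + 1) ^ 2) * ρ) ≤ 2)
  (hρc : 2 * ρ ≤ c3 d L) {C₄ a₃ : ℝ} (hC₄ : 0 ≤ C₄) (ha₃ : 0 < a₃)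

-- deep definitional unfolding `laplaceAkPi` ↦ `laplaceALatticeK … (π†Δπ) …` in the statement (as the host)
set_option maxRecDepth 8192 in
set_option maxHeartbeats 1600000 in -- (I-7)'s ≈ 60-binder theorem applied once + the chart term
include hd hL2 hL3 hMφ hMφ' hφ hφ' ha ha' hτ hCτ hτm hMτ hρw hτ₁ hτ₂ hφτ hα₀ hα3 hα4 hαL hρ0 hρ hρc hC₄ ha₃ in
/-- **THE VACUUM OF EVERY LATTICE OF THE TOWER LIES IN ONE CHART BALL** — (I-7) at `ω = Ω = 1`, read at `U ≡ 1`, `α = 0`, `j₀ = 0`, the top-level weight profile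
`lev₀ = lev₁ ≡ n+1` and ANY `levB`: for every height, spacing on the diagonal, period and admissible (L3) slot, `∃ h52 hpos′ hposπ` and the triple (Ψ1)–(Ψ3) for
every `Φ` agreeing with the chart at the vacuum.  The `∃`-first block of (I-7) is therefore inhabited SIMULTANEOUSLY for all lattices. [folklore]
[cite: Balaban1985BackgroundPropagators, (3.122) p.420, (3.35)–(3.36) p.396; Balaban1985Variational, (174) p.305, Prop. 6 (117)–(121) p.295] -/
theorem flat_chart_lattice_uniform :
    ∃ α₁ j₁ ε₄ εC Rb R' : ℝ, 0 < α₁ ∧ 0 < j₁ ∧ 0 < Rb ∧ 0 < R' ∧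
      ∀ (n : ℕ) (η : ℝ) [Fact (0 < η)] (_hηL : η * (L : ℝ) ^ (n + 1) = 1) (c₀ c₁ : ℝ) [Fact (0 < c₀)] [Fact (0 < c₁)]
        (_hw : c₀ * ((L : ℝ) ^ (n + 1)) ^ d = c₁) (_hc₀η : c₀ = η ^ d) (_hρ : |η| ^ d / c₀ ≤ ρw) (m : Fin d → ℕ) [∀ i, NeZero (m i)] (_hm : ∀ i, 1 ≤ m i)
        (levB : Bond d m → ℕ)
        {Wq : Space115 (L : ℝ) η (fun _ : Bond d (towerP L m (n + 1)) => n + 1) (fun _ : Bond d (towerP L m (n + 1)) × Fin d => n + 1)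
          (nabla115 η (fun _ : Bond d (towerP L m (n + 1)) => (1 : 𝔸ˣ))) → NegSize (L : ℝ) η (fun _ : Bond d (towerP L m (n + 1)) => n + 1) 3 𝔸},
        QuadAnalytic Wq C₄ a₃ → AnalyticOnNhd ℂ Wq {Y | ‖Y‖ < a₃} →
      ∃ h52 : pdev (perCfg (towerP L m (n + 1)) (fun _ : Bond d (towerP L m (n + 1)) => (1 : 𝔸ˣ))) < α₀ * (((L : ℝ) ^ (n + 1))⁻¹) ^ 2,
      ∃ hpos' : ∀ x : SiteL2K ℂ d (towerP L m (n + 1)) c₀ W, x ≠ 0 →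
          0 < RCLike.re ⟪x, laplacePrimeAk L m n φ η (fun _ : Bond d (towerP L m (n + 1)) => (1 : 𝔸ˣ)) a' (c₁ := c₁) x⟫_ℂ,
      ∃ hposπ : ∀ x : BondL2K ℂ d (towerP L m (n + 1)) c₀ W, x ≠ 0 →
          0 < RCLike.re ⟪x, laplaceAkPi L m n φ τ η (fun _ : Bond d (towerP L m (n + 1)) => (1 : 𝔸ˣ)) a' hpos' hL (fun j => αT d L α₀ * (((L : ℝ) ^ min (j + 1) (n + 1))⁻¹) ^ 2)
            (fun j => (geomProfile_le_αT (d := d) L (n + 1) hL hα₀.le j).trans (αT_le hL hα4))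
            (ulev_mem_U1_of_pdev L m (n + 1) (fun _ : Bond d (towerP L m (n + 1)) => (1 : 𝔸ˣ)) hL2 (avgClosed_unitaryUnits d L) (flat_mem_class L m n η).1 hα₀ hα3 hα4 h52)
            (ulev_reg_of_pdev_geometric L m (n + 1) (fun _ : Bond d (towerP L m (n + 1)) => (1 : 𝔸ˣ)) hL2 (avgClosed_unitaryUnits d L) (flat_mem_class L m n η).1 hα₀ hα3 hα4 h52) (c₁ := c₁) a x⟫_ℂ,
      ∀ (Φ : NegSize (L : ℝ) η levB 0 𝔸 → Space115 (L : ℝ) η (fun _ : Bond d (towerP L m (n + 1)) => n + 1)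
          (fun _ : Bond d (towerP L m (n + 1)) × Fin d => n + 1) (nabla115 η (fun _ : Bond d (towerP L m (n + 1)) => (1 : 𝔸ˣ)))),
        Φ = (chartHB (frakGLatticeCLM (lev₀ := fun _ => n + 1) φ hposπ
              (QkW_surjective L m n φ (fun _ : Bond d (towerP L m (n + 1)) => (1 : 𝔸ˣ)) hL _ _ _ _ fun j => le_trans (mul_le_mul_of_nonneg_right (mul_le_mul_of_nonneg_left
                (geomProfile_le_αT (d := d) L (n + 1) hL hα₀.le j) (by positivity)) (by positivity)) hαL) (fun _ => n + 1) (nabla115 η (fun _ : Bond d (towerP L m (n + 1)) => (1 : 𝔸ˣ))))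
            0 Wq 0 (fun A' => A' + solA (H1LatticeCLM (lev₀ := fun _ => n + 1) (levB := levB) φ hposπ
              (QkW_surjective L m n φ (fun _ : Bond d (towerP L m (n + 1)) => (1 : 𝔸ˣ)) hL _ _ _ _ fun j => le_trans (mul_le_mul_of_nonneg_right (mul_le_mul_of_nonneg_left
                (geomProfile_le_αT (d := d) L (n + 1) hL hα₀.le j) (by positivity)) (by positivity)) hαL) (fun _ => n + 1) (nabla115 η (fun _ : Bond d (towerP L m (n + 1)) => (1 : 𝔸ˣ)))) 0
              (Cck L m η (n + 1) (fun _ : Bond d (towerP L m (n + 1)) => (1 : 𝔸ˣ)) (fun _ => n + 1) (fun _ => n + 1) (nabla115 η (fun _ : Bond d (towerP L m (n + 1)) => (1 : 𝔸ˣ))) levB) 0 εC A') ε₄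
            (H1LatticeCLM (lev₀ := fun _ => n + 1) (levB := levB) φ hposπ
              (QkW_surjective L m n φ (fun _ : Bond d (towerP L m (n + 1)) => (1 : 𝔸ˣ)) hL _ _ _ _ fun j => le_trans (mul_le_mul_of_nonneg_right (mul_le_mul_of_nonneg_left
                (geomProfile_le_αT (d := d) L (n + 1) hL hα₀.le j) (by positivity)) (by positivity)) hαL) (fun _ => n + 1) (nabla115 η (fun _ : Bond d (towerP L m (n + 1)) => (1 : 𝔸ˣ))))) →
        DifferentiableOn ℂ Φ (ball (0 : NegSize (L : ℝ) η levB 0 𝔸) Rb) ∧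
          MapsTo Φ (ball (0 : NegSize (L : ℝ) η levB 0 𝔸) Rb)
            (ball (0 : Space115 (L : ℝ) η (fun _ : Bond d (towerP L m (n + 1)) => n + 1) (fun _ : Bond d (towerP L m (n + 1)) × Fin d => n + 1)
              (nabla115 η (fun _ : Bond d (towerP L m (n + 1)) => (1 : 𝔸ˣ)))) R') ∧ Φ 0 = 0 := by
  obtain ⟨α₁, j₁, ε₄, εC, Rb, R', hα₁, hj₁, hRb0, hR'0, HC⟩ :=
    cur_chart_exists_tower_pi_of_unitary_class_lattice_uniform hd L hL hL2 hL3 φ hMφ hMφ' hφ hφ' ha ha' τ hτ hCτ hτm hMτ hρw hτ₁ hτ₂ hφτ hα₀ hα3 hα4 hαL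
      hρ0 hρ hρc hC₄ ha₃ (zero_le_one : (0 : ℝ) ≤ 1) (zero_le_one : (0 : ℝ) ≤ 1)
  refine ⟨α₁, j₁, ε₄, εC, Rb, R', hα₁, hj₁, hRb0, hR'0, ?_⟩
  intro n η _ hηL c₀ c₁ _ _ hw hc₀η hρ' m _ hm levB Wq hW hWa
  obtain ⟨hUG, hUη, hpl, hUgrad, hJ⟩ := flat_mem_class L m n η (𝔸 := 𝔸)
  have hw1 := topLevel_weights (ι := Bond d (towerP L m (n + 1))) (L := (L : ℝ)) hηL 1
  have hw2 := topLevel_weights (ι := Bond d (towerP L m (n + 1)) × Fin d) (L := (L : ℝ)) hηL 2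
  have hw3 := topLevel_weights (ι := Bond d (towerP L m (n + 1))) (L := (L : ℝ)) hηL 3
  have hwB := zeroExp_weights (L := (L : ℝ)) (η := η) levB
  obtain ⟨h52, hpos', hposπ, hΨ⟩ := HC n η hηL c₀ c₁ hw hc₀η hρ' m hm _ hUG 0 le_rfl hα₁.le hUη hpl hUgrad 0 hJ hj₁.le
    (fun _ => n + 1) (fun _ => n + 1) levB (fun _ => le_rfl) hw1.1 hw2.1 hw3.2 hwB hW hWa
  exact ⟨h52, hpos', hposπ, fun Φ hΦ => hΦ ▸ hΨ⟩

end Corollary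

end Summit.QuantumFields.BalabanUV.T4Continuum.NE9CurChartTowerPiLatticeUniformFlatWitness

end
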